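import Mathlib
import Literature.NumberTheory.Transcendental.KZCalculusProofs
import Literature.NumberTheory.Transcendental.KZCubicalCalculus
import Literature.NumberTheory.Transcendental.KZVolumeConjectureProofs
import Literature.NumberTheory.Transcendental.KZUnfolding
import Literature.NumberTheory.Transcendental.KZSemiCanonicalReductionProofs

/-!
# OffTetraSectorKernel (stmt-KontsevichZagierPeriods-10557), line odd-hyperbolic-ladder: stub stub_kernelOfValueOne

VALUE-ONE TRANSFER (oracle-generic). Let `W` be any subgroup of the formal group `KZ.FormalRep`.
If, in every dimension `d`, every integral representation of value exactly `1` is move-equivalent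
modulo `relations ⊔ W` to the unit cube `[0,1]^d` with integrand `1`, then every element of the
kernel of evaluation lies in `relations ⊔ W`.

Proof. The kernel hypothesis `eval c = 0` is spent once: modulo `relations` one has
`c ≡ [r] − [r'] ≡ [r] + [r'.neg] ≡ [R₀]` (`KZ.exists_integralRep_sub_holds`,
`KZ.of_add_of_neg_mem_levelRel`, `KZ.IntegralRep.exists_of_add_of_sub_of_mem_relations`), so
`R₀` has value `0`; adding the point `[Q₀]` (the cube of dimension `0`, value `1`) gives
`c + [Q₀] ≡ [R₁]` with `R₁` ONE representation of value `1`, which the hypothesis connects to the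
cube `[Q₁]` of its dimension; the same hypothesis applied to the raise `R` of `Q₀` to that
dimension (`KZ.IntegralRep.exists_equivalent_of_le`, value `1` by soundness) connects `[Q₀]` to
`[Q₁]` as well, and the bookkeeping closes in the free abelian group.
-/

noncomputable section

open Set MeasureTheory
open Literature.NumberTheory.Transcendental

namespace Summit.KontsevichZagierPeriods.HyperbolicBloch.OffTetraSectorKernel

/-- The unit cube `[0,1]^d` carries an integral representation with integrand `1`
(`KZ.exists_oneRep` on the `ℚ`-semialgebraic finite-volume set `KZ.cube d`). [folklore] -/
theorem kov_exists_cubeRep (d : ℕ) :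
    ∃ Q : KZ.IntegralRep d, Q.domain = KZ.cube d ∧ ∀ x ∈ Q.domain, Q.integrand x = 1 := by
  obtain ⟨Q, hQd, hQi⟩ := KZ.exists_oneRep (KZ.isSemialgebraic_cube (n := d)) (by simp)
  exact ⟨Q, hQd, fun x _ => by simp [hQi]⟩

/-- A representation on the unit cube `[0,1]^d` with integrand `1` has value `vol [0,1]^d = 1`.
[folklore] -/
theorem kov_value_eq_one_of_cube {d : ℕ} {Q : KZ.IntegralRep d} (hQd : Q.domain = KZ.cube d)
    (hQi : ∀ x ∈ Q.domain, Q.integrand x = 1) : Q.value = 1 := by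
  rw [Q.value_eq_volume_real hQi, hQd, KZ.volume_real_cube]

/-- STUB `stub_kernelOfValueOne` (VALUE-ONE TRANSFER): if every representation of value `1`, in
every dimension, reaches the unit cube of its dimension modulo `relations ⊔ W`, then every kernel
element lies in `relations ⊔ W`. [cite: KontsevichZagier2001, §1.2] -/
theorem stub_kernelOfValueOne (W : AddSubgroup KZ.FormalRep)
    (hone : ∀ (d : ℕ) (G Q : KZ.IntegralRep d), Q.domain = KZ.cube d →
      (∀ x ∈ Q.domain, Q.integrand x = 1) → G.value = 1 → KZ.of G - KZ.of Q ∈ KZ.relations ⊔ W)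
    (c : KZ.FormalRep) (hc : KZ.eval c = 0) : c ∈ KZ.relations ⊔ W := by
  -- `c ≡ [r] - [r']` modulo relations
  obtain ⟨n, m, r, r', hsub⟩ := KZ.exists_integralRep_sub_holds c
  -- `[r'] + [r'.neg]` is a relation (signs live in the integrand)
  have hneg : KZ.of r' + KZ.of r'.neg ∈ KZ.relations :=
    KZ.levelRel_le_relations (KZ.of_add_of_neg_mem_levelRel r')
  -- merge `r` and `r'.neg` into one representation `R₀` (value `0`)
  obtain ⟨N, R₀, hR₀⟩ := r.exists_of_add_of_sub_of_mem_relations r'.neg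
  -- the point: the cube of dimension `0`, value `1`
  obtain ⟨Q₀, hQ₀d, hQ₀i⟩ := kov_exists_cubeRep 0
  -- merge `R₀` and `Q₀` into one representation `R₁` (value `1`)
  obtain ⟨N₁, R₁, hR₁⟩ := R₀.exists_of_add_of_sub_of_mem_relations Q₀
  -- the cube of dimension `N₁`
  obtain ⟨Q₁, hQ₁d, hQ₁i⟩ := kov_exists_cubeRep N₁
  -- raise the point `Q₀` to dimension `N₁`
  obtain ⟨R, hR⟩ := Q₀.exists_equivalent_of_le (Nat.zero_le N₁)
  -- values
  have hQ₀v : Q₀.value = 1 := kov_value_eq_one_of_cube hQ₀d hQ₀i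
  have hRv : R.value = 1 := (KZ.Equivalent.value_eq_holds hR).symm.trans hQ₀v
  have hR₁v : R₁.value = 1 := by
    have e₁ : KZ.eval (c - (KZ.of r - KZ.of r')) = 0 := KZ.eval_eq_zero_of_mem_relations hsub
    have e₂ : KZ.eval (KZ.of r + KZ.of r'.neg - KZ.of R₀) = 0 :=
      KZ.eval_eq_zero_of_mem_relations hR₀
    have e₃ : KZ.eval (KZ.of R₀ + KZ.of Q₀ - KZ.of R₁) = 0 :=
      KZ.eval_eq_zero_of_mem_relations hR₁
    simp only [map_sub, map_add, KZ.eval_of, KZ.IntegralRep.value_neg, hc, hQ₀v] at e₁ e₂ e₃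
    linarith
  -- the two uses of the value-one hypothesis, in dimension `N₁`
  have h₁ : KZ.of R₁ - KZ.of Q₁ ∈ KZ.relations ⊔ W := hone N₁ R₁ Q₁ hQ₁d hQ₁i hR₁v
  have h₂ : KZ.of R - KZ.of Q₁ ∈ KZ.relations ⊔ W := hone N₁ R Q₁ hQ₁d hQ₁i hRv
  -- bookkeeping in the free abelian group
  have key : c = c - (KZ.of r - KZ.of r') + (KZ.of r + KZ.of r'.neg - KZ.of R₀)
      - (KZ.of r' + KZ.of r'.neg) + (KZ.of R₀ + KZ.of Q₀ - KZ.of R₁) + (KZ.of R₁ - KZ.of Q₁)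
      - (KZ.of R - KZ.of Q₁) - (KZ.of Q₀ - KZ.of R) := by
    abel
  rw [key]
  exact sub_mem (sub_mem (add_mem (add_mem (sub_mem (add_mem (AddSubgroup.mem_sup_left hsub)
    (AddSubgroup.mem_sup_left hR₀)) (AddSubgroup.mem_sup_left hneg))
    (AddSubgroup.mem_sup_left hR₁)) h₁) h₂) (AddSubgroup.mem_sup_left hR)

end Summit.KontsevichZagierPeriods.HyperbolicBloch.OffTetraSectorKernel

end
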